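/-
Origin: expansion seat `planner-pub-hodgecm-mc-sanity-1-g9-0`, handover #1b 2026-08-19T16:22Z md5 d1d1212f0b67 (SUPERSEDES 7a9a1d2b2f4d: docstring tokens «proof-hole-free»/«axioms ⊆» reworded to «no proof holes»/«`#print axioms` ⊆», code byte-identical) (NEW additive census leaf SAN-18, 204 l., 11 decls in ns HodgeCM.Model.Sanity, imports row #1 only: `degThetaSpaceInputFull` (G_U := arbitrary locally compact G₀, trivialPairData, ι_∞ := 1, KΓ := ⊤), `degKTypeSituationFull` (Kc := G₀, κ := id, τ := σ := 1), `_isSaturated_top` / `_isStrict` (both `rfl`-level: `act_s_trivialPairData`), `degSupplySituationAtFull`, `nonempty_supplySituationAt_degFull`, `ker_subset_thetaOf_degFull`; verdict: (Θ-sat)'s new Prop fields `sat`/`strict` are free at BOTH extremes of the saturation index over trivial-action data — content of (C-KfSat) sits in the PIN (honest ω, `satLevel Γ.K`), i.e. in `ArchKTypeData.sat` over `pinX`; same build: rc 0, 0 warnings, 0 proof-hole, axioms 11/11 ⊆ trio) (`HOME/mc/pub-hodgecm-mc-sanity-1-g8/next37/HodgeCM/Model/Sanity/ThetaSpaceInputDegenerateSat.lean`,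 md5 d1d1212f, 205 lines);
landed by the gen-13 packager (p-g13) in gate run 37 as `HodgeCM/Model/Sanity/ThetaSpaceInputDegenerateSat.lean` (verbatim).
-/
/-
Copyright (c) 2026. All rights reserved.
Released under Apache 2.0 license as described in the file LICENSE.

# SAN-18 — the (Θ-sat) binder profile: saturation at the FULL index and strictness are free over trivial pair data

Origin: SANITY lane `planner-pub-hodgecm-mc-sanity-1-g8-0` (unit pub-hodgecm-mc-sanity-1-g8, gen 8 of mc-sanity-1),
2026-08-19 — NEW census leaf for RUN 37, additive and drop-on-bounce; install AFTER the (Θ-sat) re-stage of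
`Model/Sanity/ThetaSpaceInputDegenerate` (row 1 of kit `t37-mcsanity1g8.txt`), which itself follows mc-theta-3's
RUN-37 packet (`Model/ThetaSpaceSat` NEW, `Model/ThetaClassInputInstance` (Θ-sat)).  Never RUN 36.

WHAT IT CHECKS.  mc-theta-3's (Θ-sat) re-cut adds to E's DATA binder `X : ThetaSpaceInput` the field
`KΓ : Level V → Subgroup GU` (the saturation index; at the pin `satLevel (Γ.K)`) and shrinks `Θ_k(Γ)` to the theta
forms of `K`-type situations that are SATURATED along `KΓ Γ` (`∀ k ∈ KΓ Γ, ∃ c, κ c = k ∧ τ c = 1`) and STRICT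
(every test family intertwines on the nose: `j (σ c e) = ω(s(κ c, 1)) (j e)`); E's binder `A` (`SupplySituationAt`)
gains the matching proof fields `sat`, `strict`.  Row 1 re-staged the degenerate input with the SMALLEST index
`KΓ := ⊥` (saturation vacuous).  This leaf instantiates the OPPOSITE extreme: an ARBITRARY locally compact adelic
group `G₀` as `G_U`, the trivial pair action `ω := 1` (`Sanity.trivialPairData K K J G₀`), the trivial archimedean
inclusion `ι_∞ := 1`, and the FULL saturation index `KΓ := ⊤` — and exhibits a supply situation there
(`degSupplySituationAtFull`): `Kc := G₀`, `κ := id`, `τ := 1`, `σ := 1`, so `IsSaturated ⊤` holds with `c := k`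
and `IsStrict` holds because `ω(s(k, 1)) = 1(k, 1) = 1` acts as the identity — both by `rfl`.

VERDICT (binder-type column; no objection to theta-3's files, which are honestly typed): the two new Prop fields of
(Θ-sat) carry NO content on their own — they are satisfiable at BOTH extremes of the saturation index (`⊥`, row 1;
`⊤`, here) by trivial-action data, for every `k` and `N`, as soon as one level carries a nonzero functional on `H¹`.
Exactly as for R7 (row 1's verdict), the content that (Θ-sat) routes into `supply_k φ_N` — (C-KfSat): saturation of
an HONEST compact-open level `K_f` acting through the HONEST Weil representation `ω_k` — lives in the PIN of `X`
(`P k :=` the Weil pair representation, `KΓ Γ := satLevel (Γ.K)`), i.e. in E's `ArchKTypeData.sat` over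
`pinX`, not in the shape of `A`.  So under (Θ-sat) the pair `(X, A)` stays JOINTLY CHEAP and `X` stays an UNPINNED
DATA binder until the pin is the `def` of record (it is: `Model.ThetaSpaceInputPin.thetaSpaceInputIn`, RUN 34), at
which point the census of `A` is the census of `C : ArchKTypeData (pinX …) k N` (SAN-10b/SAN-13: EMPTY over the
archimedean-trivial side `degS`, honest elsewhere).

Contents (namespace `HodgeCM.Model.Sanity`): `degThetaSpaceInputFull` (+ `_P`, `_KΓ` rfl lemmas),
`degKTypeSituationFull`, `degKTypeSituationFull_isSaturated_top`, `degKTypeSituationFull_isStrict`,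
`isThetaEquivariant_id_trivialPairData'` (any `G₀`), `degSupplySituationAtFull`, `nonempty_supplySituationAt_degFull`,
`ker_subset_thetaOf_degFull` (the § 3 verdict of row 1 verbatim at `KΓ := ⊤`: `Θ_k(Γ) ⊇ ker Λ`).
Budget: 11 declarations (8 named above + `act_s_trivialPairData` and the two rfl lemmas); imports = row 1 only; no proof
holes; `#print axioms` ⊆ {propext, Classical.choice, Quot.sound} (11/11, author overlay build over theta-3-g8 draft shapes).
-/
import Summits.HodgeConjecture.HodgeCM.Model.Sanity.ThetaSpaceInputDegenerate

set_option autoImplicit false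

noncomputable section

open Set Function
open MeasureTheory NumberField NumberField.mixedEmbedding
open Literature.NumberTheory.Automorphic Literature.NumberTheory.Weil1964
open Literature.NumberTheory.Automorphic.WeightForms (ClassMapDatum thetaClasses restrictHom IsLevelCorrected
  IsWeightMatched)
open Literature.AlgebraicGeometry.HodgeTheory
open Literature.NumberTheory.Automorphic.PicardCM
open HodgeCM.PerL34.SupplyAdelic HodgeCM.Model.SupplyInstance
open HodgeCM.Model.SupplyResidual HodgeCM.Model.ThetaSpace
open scoped SchwartzMap Classical

namespace HodgeCM
namespace Model
namespace Sanity

attribute [local instance] ratModule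

/-! ## § 1. The degenerate input over an arbitrary adelic group, FULL saturation index -/

section Input

variable (U : Universe) {K : Type} [Field K] [NumberField K] {J : Type} [Fintype J]
  (Φinf : 𝓢((J → mixedSpace K), ℂ)) (x₀ : J → K) (hx₀ : Φinf (archEmb K J x₀) ≠ 0)
  (G₀ : Type) [Group G₀] [TopologicalSpace G₀] [IsTopologicalGroup G₀] [LocallyCompactSpace G₀]
variable {Lc : CMField} {ι₁ : Lc →+* ℂ} (V : HermSpace3 Lc ι₁) (c : SeesawCtx Lc)
  (Λ : ∀ Γ : Level V, Module.Dual ℂ (U.CohC (U.pms Lc ι₁ V Γ) 1))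

/-- **The degenerate theta-space input at full saturation index**: row 1's `degThetaSpaceInput` with `G_U := G₀`
an ARBITRARY locally compact group carrying the trivial pair datum, `ι_∞ := 1`, and `KΓ := ⊤`. -/
def degThetaSpaceInputFull : ThetaSpaceInput U V c where
  G₁ := PUnit.{1}
  K₁ := PUnit.{1}
  κ₁ := MonoidHom.id PUnit.{1}
  W := ℂ
  τ₁ := 1
  Δ := fun _ => ⊤
  D := fun Γ => functionalClassMapDatum (MonoidHom.id PUnit.{1})
    (isLevelCorrected_id ⊤ (MonoidHom.id PUnit.{1}) 1) (isWeightMatched_id (MonoidHom.id PUnit.{1}) 1) (Λ Γ)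
  K := K
  L := K
  J := J
  GU := G₀
  P := fun _ => trivialPairData K K J G₀ Φinf x₀ hx₀
  instCompact := fun _ => compactSpace_quotient_top
  ιinf := fun _ => 1
  KΓ := fun _ => ⊤

/-- (Ported verbatim from the HodgeCMPerL package; no docstring in the source.) -/
@[simp] theorem degThetaSpaceInputFull_P (k : Fin 4) :
    (degThetaSpaceInputFull U Φinf x₀ hx₀ G₀ V c Λ).P k = trivialPairData K K J G₀ Φinf x₀ hx₀ := rfl

/-- (Ported verbatim from the HodgeCMPerL package; no docstring in the source.) -/
@[simp] theorem degThetaSpaceInputFull_KΓ (Γ : Level V) :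
    (degThetaSpaceInputFull U Φinf x₀ hx₀ G₀ V c Λ).KΓ Γ = ⊤ := rfl

end Input

/-! ## § 2. A saturated, strict `K`-type situation at `φ_N` with `Kc := G₀` -/

section Supply

variable {K : Type} [Field K] [NumberField K] {J : Type} [Fintype J]
  (Φinf : 𝓢((J → mixedSpace K), ℂ)) (x₀ : J → K) (hx₀ : Φinf (archEmb K J x₀) ≠ 0)
  (G₀ : Type) [Group G₀] [TopologicalSpace G₀] [IsTopologicalGroup G₀] [LocallyCompactSpace G₀]

/-- Over the TRIVIAL pair action `ω := 1` of any group, `ω(s(k, 1))` acts as the identity on `𝒮`. -/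
theorem act_s_trivialPairData (k : G₀) (Φ : (trivialPairData K K J G₀ Φinf x₀ hx₀).weilDatum.ThetaTop) :
    (trivialPairData K K J G₀ Φinf x₀ hx₀).kernelDatum.W.act
      ((trivialPairData K K J G₀ Φinf x₀ hx₀).kernelDatum.s (k, 1)) Φ = Φ := rfl

/-- The identity test family of the trivial pair datum is theta-equivariant for `Kc := G₀`, `κ := id`, trivial
action (any `G₀`; row 1's `isThetaEquivariant_id_trivialPairData` is the case `G₀ = Unit`). -/
theorem isThetaEquivariant_id_trivialPairData' :
    (trivialPairData K K J G₀ Φinf x₀ hx₀).kernelDatum.IsThetaEquivariant (MonoidHom.id G₀)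
      (1 : Representation ℂ G₀ (trivialPairData K K J G₀ Φinf x₀ hx₀).weilDatum.ThetaTop) LinearMap.id :=
  ThetaKernelDatum.isThetaEquivariant_of_act _ fun k e => (act_s_trivialPairData Φinf x₀ hx₀ G₀ k e).symm

/-- **The `K`-type situation of `φ_N` with `Kc := G₀`** over the trivial pair datum: `κ := id`, `E := 𝒮` with the
trivial action, `τ := 1`, `ι ℓ := ℓ 1 • φ_N`, `η₁ := 1`, all theta-equivariant families as test families. -/
def degKTypeSituationFull (N : ℕ) :
    KTypeSituation (trivialPairData K K J G₀ Φinf x₀ hx₀) (1 : PUnit.{1} →* G₀) (⊤ : Subgroup PUnit.{1})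
      (MonoidHom.id PUnit.{1}) (1 : Representation ℂ PUnit.{1} ℂ) where
  Kc := G₀
  κ := MonoidHom.id G₀
  E := (trivialPairData K K J G₀ Φinf x₀ hx₀).weilDatum.ThetaTop
  σ := 1
  τ := 1
  ι :=
    { toFun := fun ℓ => ℓ 1 • (trivialPairData K K J G₀ Φinf x₀ hx₀).testFunT N
      map_add' := fun a b => by rw [LinearMap.add_apply, add_smul]
      map_smul' := fun a ℓ => by rw [LinearMap.smul_apply, RingHom.id_apply, smul_eq_mul, mul_smul] }
  hι x ℓ := by
    have h1 : (1 : Representation ℂ G₀ ℂ).dual x ℓ = ℓ := by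
      rw [Representation.dual_apply, MonoidHom.one_apply, Module.Dual.transpose_apply]
      exact LinearMap.comp_id ℓ
    rw [h1, MonoidHom.one_apply, Module.End.one_apply]
  η₁ := 1
  hΔ := fun _ _ => ⟨1, map_one _, Subgroup.mem_top _, fun _ => by rw [map_one]; exact Commute.one_left _⟩
  hη := ⟨fun _ => by rw [MonoidHom.one_apply, map_one], fun _ => rfl⟩
  𝓙 := univ

/-- **Saturated at the FULL index**: every `k ∈ ⊤ = G₀` is `κ k` with `τ k = 1`. -/
theorem degKTypeSituationFull_isSaturated_top (N : ℕ) :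
    (degKTypeSituationFull Φinf x₀ hx₀ G₀ N).IsSaturated ⊤ :=
  fun k _ => ⟨k, rfl, rfl⟩

/-- **Strict**: with the trivial action on `E := 𝒮` and `ω(s(κ c, 1)) = 1` every family intertwines on the nose. -/
theorem degKTypeSituationFull_isStrict (N : ℕ) : (degKTypeSituationFull Φinf x₀ hx₀ G₀ N).IsStrict :=
  fun j _ c e => (act_s_trivialPairData Φinf x₀ hx₀ G₀ c (j.1 e)).symm

variable (U : Universe) {Lc : CMField} {ι₁ : Lc →+* ℂ} (V : HermSpace3 Lc ι₁) (c : SeesawCtx Lc)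
  (Λ : ∀ Γ : Level V, Module.Dual ℂ (U.CohC (U.pms Lc ι₁ V Γ) 1))

/-- **A supply situation at `φ_N` for the full-index degenerate input**, for EVERY `k` and `N`, at any level whose
functional is nonzero — `sat` and `strict` included. -/
def degSupplySituationAtFull (k : Fin 4) (N : ℕ) (Γ₀ : Level V) (hΛ : Λ Γ₀ ≠ 0) :
    SupplySituationAt (degThetaSpaceInputFull U Φinf x₀ hx₀ G₀ V c Λ) k N where
  Γ₀ := Γ₀
  S := degKTypeSituationFull Φinf x₀ hx₀ G₀ N
  fam := ⟨⟨LinearMap.id, isThetaEquivariant_id_trivialPairData' Φinf x₀ hx₀ G₀⟩, mem_univ _, LinearMap.id, by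
    show (1 : ℂ) • (trivialPairData K K J G₀ Φinf x₀ hx₀).testFunT N = _
    exact one_smul ℂ _⟩
  hol _ _ f _ := mem_functionalClassMapDatum_Hol (Λ Γ₀) hΛ _
  sat := degKTypeSituationFull_isSaturated_top Φinf x₀ hx₀ G₀ N
  strict := degKTypeSituationFull_isStrict Φinf x₀ hx₀ G₀ N

/-- Hence `SupplySituationAt (X_full V c) k N` — saturation at `KΓ := ⊤` and strictness included — is inhabited for
every `k` and `N` as soon as one level carries a nonzero functional on `H¹`. -/
theorem nonempty_supplySituationAt_degFull (hΛ : ∃ Γ₀ : Level V, Λ Γ₀ ≠ 0) (k : Fin 4) (N : ℕ) :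
    Nonempty (SupplySituationAt (degThetaSpaceInputFull U Φinf x₀ hx₀ G₀ V c Λ) k N) :=
  let ⟨Γ₀, h⟩ := hΛ
  ⟨degSupplySituationAtFull Φinf x₀ hx₀ G₀ U V c Λ k N Γ₀ h⟩

end Supply

/-! ## § 3. The verdict on the END STATE's `Θ_k(Γ)` at full index: still a hyperplane (or all of `H¹`) -/

section Verdicts

variable (U : Universe) {K : Type} [Field K] [NumberField K] {J : Type} [Fintype J]
  (Φinf : 𝓢((J → mixedSpace K), ℂ)) (x₀ : J → K) (hx₀ : Φinf (archEmb K J x₀) ≠ 0)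
  (G₀ : Type) [Group G₀] [TopologicalSpace G₀] [IsTopologicalGroup G₀] [LocallyCompactSpace G₀]
  (Λ : ∀ {Lc : CMField} {ι₁ : Lc →+* ℂ} (V : HermSpace3 Lc ι₁) (Γ : Level V),
    Module.Dual ℂ (U.CohC (U.pms Lc ι₁ V Γ) 1))
variable {Lc : CMField} {ι₁ : Lc →+* ℂ} (V : HermSpace3 Lc ι₁) (c : SeesawCtx Lc) (k : Fin 4) (Γ : Level V)

/-- **Every class killed by `Λ V Γ` is a theta class of the END STATE** through the full-index degenerate input (the
zero form is a saturated strict theta form). -/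
theorem ker_subset_thetaOf_degFull :
    {h | Λ V Γ h = 0} ⊆
      thetaOf U (thetaClassInputOf U fun V c => degThetaSpaceInputFull U Φinf x₀ hx₀ G₀ V c (Λ V)) V c k Γ := by
  rw [thetaOf_thetaClassInputOf]
  exact fun h h0 => mem_thetaClasses_functional_of_apply_eq_zero _ _ h0

end Verdicts

end Sanity
end Model
end HodgeCM

end
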